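import Summits.AtomisticToContinuum.Crystallization.Theorems.OverbindingBudgetEdgeRelaxation

/-!
# OverbindingBudget — «EdgeRelaxation»: the scale-free typing of strained balls and the typed split (decomp-a2c lens-4, generation 26)

Helper file (`--supports stmt-AtomisticToContinuum-31280`; statements in `…OverbindingBudgetEdgeRelaxationStatements`, reductions in
`…OverbindingBudgetEdgeRelaxation`).  Proved here, complete:

* §I `types_of_violators` — THE TYPING.  In a uniformly discrete texture passing `RT a T₀` everywhere (`47/50 ≤ a ≤ 1`, `T₀ ≤ 1/20`), if an
  `L`-ball about `q` contains, for EVERY admissible scale `a' ∈ [47/50, 1]`, a site failing `RT a' s` (`s ≥ 0`), then the ball has one of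
  the five SCALE-FREE types at margin `s`: `LongAt` (a near pair `> 51/50 + s`), `ShortAt` (a pair `< 49/50·47/50 − s`), `LowGapAt` (a far
  pair `< 63/50·47/50 − s`), `ContrastAt` (two near pairs, `49/50·d₁ − 51/50·d₂ > 2s`), `GapClashAt` (near `d₁`, far `d₂`,
  `63/50·d₁ − 51/50·d₂ > 57/25·s`).  Proof: otherwise the longest near pair `M` of the ball fits the scale `a' = max(47/50, (M − s)·50/51) ≤ 1`
  and every site of the ball passes `RT a' s` (the two counting clauses come from the global `RT a T₀` structure: near pairs are `≤ 1.07`,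
  nothing between `11/10` and `63/50·a − T₀`).
* §J transport of types along recurrence returns (`partner_of_match`, `dist_transport`, `recur4`): in a uniformly recurrent texture a
  type present at `0` with margin `s` is present with margin `s/2` within `L + G + 1` of EVERY site (`longAt_dense`, …, `gapClashAt_dense`).
* (in `…OverbindingBudgetEdgeRelaxationConverse`) the converse: every typed law follows from RELAX, hence RELAX ⟺ the five typed laws for
  `T₀ ≤ 1/20` — the five children are each KERNEL-WEAKER than RELAX and jointly equivalent to it.
* §K `edgeRelaxationLaw_of_typed : T₀ ≤ 1/20 → LongRelaxationLaw T₀ D → ShortRelaxationLaw T₀ D → LowGapRelaxationLaw T₀ D →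
  ContrastRelaxationLaw T₀ D → GapClashRelaxationLaw T₀ D → EdgeRelaxationLaw T₀ D` and the cones down to `RobustDefectLimitWindows`.
-/

noncomputable section

namespace Summit.AtomisticToContinuum.Crystallization.Theorems.OverbindingBudgetEdgeRelaxationTyping

open Filter Metric Set Topology
open scoped BigOperators
open Literature.MathematicalPhysics.StatisticalMechanics
open Summit.AtomisticToContinuum.Crystallization.Theses.OverbindingBudget (RobustDefectLimitWindows)
open Summit.AtomisticToContinuum.Crystallization.Theorems.OverbindingBudgetViolatorDensityFloor (RT)
open Summit.AtomisticToContinuum.Crystallization.Theorems.OverbindingBudgetGradedBareness (CleanlessExcessT)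
open Summit.AtomisticToContinuum.Crystallization.Theorems.OverbindingBudgetCoherentCut (CoherentResidual)
open Summit.AtomisticToContinuum.Crystallization.Theorems.OverbindingBudgetRecurrentSealStatements (UniformlyRecurrent)
open Summit.AtomisticToContinuum.Crystallization.Theorems.OverbindingBudgetRecurrentDustStatements (ThinCoresL ViolatorsL window_finite
  window_finite_lt rt_mono)
open Summit.AtomisticToContinuum.Crystallization.Theorems.OverbindingBudgetUniformCutStatements (GrossCleanBallsU)
open Summit.AtomisticToContinuum.Crystallization.Theorems.OverbindingBudgetUniformCutDensity (CleanLiouvilleBallsU)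
open Summit.AtomisticToContinuum.Crystallization.Theorems.OverbindingBudgetEdgeRelaxationStatements
open Summit.AtomisticToContinuum.Crystallization.Theorems.OverbindingBudgetEdgeRelaxation (liouBallsU_of_edgeRelaxationLaw
  rdef_of_grossU_edgeRelaxation_coherent)

/-! ## §I  The scale-free typing of a strained ball -/

/-- Under global `RT a T₀`-cleanness (`47/50 ≤ a ≤ 1`, `T₀ ≤ 1/20`) a near pair (`dist ≤ 11/10`) is a shell pair: `dist ≤ 107/100`. [this file] -/
theorem near_le {a T₀ : ℝ} {Y : Set (EuclideanSpace ℝ (Fin 3))} {y w : EuclideanSpace ℝ (Fin 3)} (ha : 47 / 50 ≤ a) (ha1 : a ≤ 1)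
    (hT₀ : T₀ ≤ 1 / 20) (hclean : ∀ y ∈ Y, RT a T₀ Y y) (hy : y ∈ Y) (hw : w ∈ Y) (hwy : w ≠ y) (hd : dist y w ≤ 11 / 10) :
    dist y w ≤ 107 / 100 := by
  obtain ⟨-, -, h3⟩ := hclean y hy
  obtain ⟨-, h | h⟩ := h3 w hw hwy
  · linarith
  · linarith

/-- **The typing of a strained ball** (proof in the module docstring). [this file] -/
theorem types_of_violators {a T₀ s L : ℝ} {Y : Set (EuclideanSpace ℝ (Fin 3))} {q : EuclideanSpace ℝ (Fin 3)}
    (hY : UniformlyDiscrete Y) (ha : 47 / 50 ≤ a) (ha1 : a ≤ 1) (hT₀ : T₀ ≤ 1 / 20) (hs : 0 ≤ s)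
    (hclean : ∀ y ∈ Y, RT a T₀ Y y)
    (hviol : ∀ a' : ℝ, 47 / 50 ≤ a' → a' ≤ 1 → ∃ y ∈ Y, dist y q ≤ L ∧ ¬ RT a' s Y y) :
    LongAt s L Y q ∨ ShortAt s L Y q ∨ LowGapAt s L Y q ∨ ContrastAt s L Y q ∨ GapClashAt s L Y q := by
  classical
  by_contra hno
  have hL' : ¬ LongAt s L Y q := fun h => hno (Or.inl h)
  have hS' : ¬ ShortAt s L Y q := fun h => hno (Or.inr (Or.inl h))
  have hG' : ¬ LowGapAt s L Y q := fun h => hno (Or.inr (Or.inr (Or.inl h)))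
  have hC' : ¬ ContrastAt s L Y q := fun h => hno (Or.inr (Or.inr (Or.inr (Or.inl h))))
  have hK' : ¬ GapClashAt s L Y q := fun h => hno (Or.inr (Or.inr (Or.inr (Or.inr h))))
  -- near pairs at sites of the ball: a finite non-empty set; its longest member
  obtain ⟨P, hP⟩ : ∃ P : Set (EuclideanSpace ℝ (Fin 3) × EuclideanSpace ℝ (Fin 3)),
      P = {p | p.1 ∈ Y ∧ p.2 ∈ Y ∧ dist p.1 q ≤ L ∧ p.2 ≠ p.1 ∧ dist p.1 p.2 ≤ 11 / 10} := ⟨_, rfl⟩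
  have hPfin : P.Finite := by
    rw [hP]
    refine ((hY.finite_inter_closedBall q L).prod (hY.finite_inter_closedBall q (L + 11 / 10))).subset ?_
    rintro ⟨y, w⟩ ⟨hy, hw, hyq, -, hyw⟩
    refine Set.mk_mem_prod ⟨hy, mem_closedBall.2 hyq⟩ ⟨hw, mem_closedBall.2 ?_⟩
    linarith [dist_triangle w y q, dist_comm y w]
  obtain ⟨y₁, hy₁, hy₁q, -⟩ := hviol 1 (by norm_num) le_rfl
  have hPne : P.Nonempty := by
    obtain ⟨-, h2, -⟩ := hclean y₁ hy₁
    have hne : ({w ∈ Y | w ≠ y₁ ∧ dist y₁ w ≤ a * (1 + 1 / 50) + T₀}).Nonempty :=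
      Set.nonempty_of_ncard_ne_zero (by omega)
    obtain ⟨w, hw, hwy, hd⟩ := hne
    exact ⟨(y₁, w), by rw [hP]; exact ⟨hy₁, hw, hy₁q, hwy, by linarith⟩⟩
  obtain ⟨pM, hpM, hmax⟩ := P.exists_max_image (fun p => dist p.1 p.2) hPfin hPne
  rw [hP] at hpM hmax
  obtain ⟨hyM, hwM, hyMq, hwMy, hMd⟩ := hpM
  obtain ⟨M, hM⟩ : ∃ M : ℝ, M = dist pM.1 pM.2 := ⟨_, rfl⟩
  have hmax' : ∀ y ∈ Y, ∀ w ∈ Y, dist y q ≤ L → w ≠ y → dist y w ≤ 11 / 10 → dist y w ≤ M := by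
    intro y hy w hw hyq hwy hd
    rw [hM]
    exact hmax (y, w) ⟨hy, hw, hyq, hwy, hd⟩
  -- consequences of the absence of each type
  have hMlong : M ≤ 51 / 50 + s := by
    by_contra h
    push Not at h
    exact hL' ⟨pM.1, hyM, pM.2, hwM, hyMq, hwMy, hMd, by linarith⟩
  have hnear : ∀ y ∈ Y, ∀ w ∈ Y, dist y q ≤ L → w ≠ y → dist y w ≤ 11 / 10 →
      dist y w ≤ M ∧ 2303 / 2500 - s ≤ dist y w ∧ 49 / 50 * M - 2 * s ≤ 51 / 50 * dist y w := by
    intro y hy w hw hyq hwy hd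
    refine ⟨hmax' y hy w hw hyq hwy hd, ?_, ?_⟩
    · by_contra h
      push Not at h
      exact hS' ⟨y, hy, w, hw, hyq, hwy, h⟩
    · by_contra h
      push Not at h
      exact hC' ⟨pM.1, hyM, pM.2, hwM, y, hy, w, hw, hyMq, hyq, hwMy, hwy, hMd, hd, by linarith⟩
  have hfar : ∀ y ∈ Y, ∀ w ∈ Y, dist y q ≤ L → 11 / 10 < dist y w →
      2961 / 2500 - s ≤ dist y w ∧ 63 / 50 * M - 57 / 25 * s ≤ 51 / 50 * dist y w := by
    intro y hy w hw hyq hd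
    refine ⟨?_, ?_⟩
    · by_contra h
      push Not at h
      exact hG' ⟨y, hy, w, hw, hyq, hd, h⟩
    · by_contra h
      push Not at h
      exact hK' ⟨pM.1, hyM, pM.2, hwM, y, hy, w, hw, hyMq, hyq, hwMy, hMd, hd, by linarith⟩
  -- the scale fitting the ball
  obtain ⟨a', ha'⟩ : ∃ a' : ℝ, a' = max (47 / 50) ((M - s) * (50 / 51)) := ⟨_, rfl⟩
  have ha'1 : 47 / 50 ≤ a' := by rw [ha']; exact le_max_left _ _
  have ha'2 : a' ≤ 1 := by rw [ha']; exact max_le (by norm_num) (by linarith)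
  have hMa' : M ≤ a' * (1 + 1 / 50) + s := by
    have : (M - s) * (50 / 51) ≤ a' := by rw [ha']; exact le_max_right _ _
    linarith
  have hlow : ∀ d : ℝ, 2303 / 2500 - s ≤ d → 49 / 50 * M - 2 * s ≤ 51 / 50 * d → a' * (1 - 1 / 50) - s ≤ d := by
    intro d h1 h2
    rcases le_total (47 / 50 : ℝ) ((M - s) * (50 / 51)) with h | h
    · rw [ha', max_eq_right h]; linarith
    · rw [ha', max_eq_left h]; linarith
  have hgap : ∀ d : ℝ, 2961 / 2500 - s ≤ d → 63 / 50 * M - 57 / 25 * s ≤ 51 / 50 * d → a' * (63 / 50) - s ≤ d := by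
    intro d h1 h2
    rcases le_total (47 / 50 : ℝ) ((M - s) * (50 / 51)) with h | h
    · rw [ha', max_eq_right h]; linarith
    · rw [ha', max_eq_left h]; linarith
  -- every site of the ball passes `RT a' s`: contradiction
  obtain ⟨y, hy, hyq, hnot⟩ := hviol a' ha'1 ha'2
  obtain ⟨hc1, hc2, hc3⟩ := hclean y hy
  refine hnot ⟨?_, ?_, fun w hw hwy => ?_⟩
  · refine le_trans (Set.ncard_le_ncard (fun w hw' => ?_) (window_finite_lt hY y _)) hc1
    obtain ⟨hw, hwy, hd⟩ := hw'
    refine ⟨hw, hwy, ?_⟩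
    by_cases hnw : dist y w ≤ 11 / 10
    · linarith
    · push Not at hnw
      obtain ⟨h1, h2⟩ := hfar y hy w hw hyq hnw
      have := hgap _ h1 h2
      linarith
  · refine hc2.trans (Set.ncard_le_ncard (fun w hw' => ?_) (window_finite hY y _))
    obtain ⟨hw, hwy, hd⟩ := hw'
    have hd' : dist y w ≤ 11 / 10 := by linarith
    exact ⟨hw, hwy, by linarith [(hnear y hy w hw hyq hwy hd').1]⟩
  · by_cases hnw : dist y w ≤ 11 / 10
    · obtain ⟨h1, h2, h3⟩ := hnear y hy w hw hyq hwy hnw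
      exact ⟨hlow _ h2 h3, Or.inl (by linarith)⟩
    · push Not at hnw
      obtain ⟨h1, h2⟩ := hfar y hy w hw hyq hnw
      exact ⟨by linarith, Or.inr (hgap _ h1 h2)⟩

/-! ## §J  Transport of types along recurrence returns -/

/-- A recurrence return `g` (`Y − g` matched to `Y` about `0`) puts a site of `Y` within `ε` of `p + g` for every site `p` of norm `≤ R`.
[folklore] -/
theorem partner_of_match {Y : Set (EuclideanSpace ℝ (Fin 3))} {ε R : ℝ} {g p : EuclideanSpace ℝ (Fin 3)}
    (hM : Match ε R 0 ((fun x => x - g) '' Y) Y) (hp : p ∈ Y) (hpR : ‖p‖ ≤ R) :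
    ∃ p' ∈ Y, dist p' (p + g) ≤ ε := by
  obtain ⟨_, ⟨p', hp', rfl⟩, hd⟩ := hM.1 p hp (by rwa [dist_zero_right])
  refine ⟨p', hp', ?_⟩
  rwa [← dist_sub_right p' (p + g) g, add_sub_cancel_right]

/-- Transported pairs have distances within `2ε`. [folklore] -/
theorem dist_transport {p w p' w' g : EuclideanSpace ℝ (Fin 3)} {ε : ℝ} (hp : dist p' (p + g) ≤ ε) (hw : dist w' (w + g) ≤ ε) :
    dist p w - 2 * ε ≤ dist p' w' ∧ dist p' w' ≤ dist p w + 2 * ε := by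
  have h0 : dist (p + g) (w + g) = dist p w := by rw [dist_eq_norm, dist_eq_norm, add_sub_add_right_eq_sub]
  have h1 := dist_triangle4 p' (p + g) (w + g) w'
  have h2 := dist_triangle4 (p + g) p' w' (w + g)
  rw [dist_comm (w + g) w'] at h1
  rw [dist_comm (p + g) p'] at h2
  constructor <;> linarith

/-- Transported sites stay within `L + G + 1` of the new centre. [folklore] -/
theorem centre_transport {y y' g q : EuclideanSpace ℝ (Fin 3)} {ε L G : ℝ} (hy : dist y 0 ≤ L) (hy' : dist y' (y + g) ≤ ε)
    (hg : dist g q ≤ G) (hε : ε ≤ 1) : dist y' q ≤ L + G + 1 := by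
  have h1 := dist_triangle4 y' (y + g) g q
  have h2 : dist (y + g) g = dist y 0 := by rw [dist_eq_norm, dist_eq_norm, add_sub_cancel_right, sub_zero]
  linarith

/-- Uniform recurrence transports four sites at once, with bounded gaps. [folklore] -/
theorem recur4 {Y : Set (EuclideanSpace ℝ (Fin 3))} (hrec : UniformlyRecurrent Y) {p₁ p₂ p₃ p₄ : EuclideanSpace ℝ (Fin 3)}
    (h₁ : p₁ ∈ Y) (h₂ : p₂ ∈ Y) (h₃ : p₃ ∈ Y) (h₄ : p₄ ∈ Y) {ε : ℝ} (hε : 0 < ε) :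
    ∃ G : ℝ, ∀ q ∈ Y, ∃ g ∈ Y, dist g q ≤ G ∧ (∃ p₁' ∈ Y, dist p₁' (p₁ + g) ≤ ε) ∧ (∃ p₂' ∈ Y, dist p₂' (p₂ + g) ≤ ε) ∧
      (∃ p₃' ∈ Y, dist p₃' (p₃ + g) ≤ ε) ∧ ∃ p₄' ∈ Y, dist p₄' (p₄ + g) ≤ ε := by
  obtain ⟨G, hG⟩ := hrec (‖p₁‖ + ‖p₂‖ + ‖p₃‖ + ‖p₄‖) ε hε
  refine ⟨G, fun q hq => ?_⟩
  obtain ⟨g, hg, hgq, hM⟩ := hG q hq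
  have n₁ := norm_nonneg p₁
  have n₂ := norm_nonneg p₂
  have n₃ := norm_nonneg p₃
  have n₄ := norm_nonneg p₄
  exact ⟨g, hg, hgq, partner_of_match hM h₁ (by linarith), partner_of_match hM h₂ (by linarith),
    partner_of_match hM h₃ (by linarith), partner_of_match hM h₄ (by linarith)⟩

/-- Type LONG recurs with bounded gaps. [this file] -/
theorem longAt_dense {a T₀ s L : ℝ} {Y : Set (EuclideanSpace ℝ (Fin 3))} (hrec : UniformlyRecurrent Y) (ha : 47 / 50 ≤ a) (ha1 : a ≤ 1)
    (hT₀ : T₀ ≤ 1 / 20) (hclean : ∀ y ∈ Y, RT a T₀ Y y) (hs : 0 < s) (h : LongAt s L Y 0) :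
    ∃ G : ℝ, ∀ q ∈ Y, LongAt (s / 2) (L + G + 1) Y q := by
  obtain ⟨y, hy, w, hw, hy0, hwy, hd, hlong⟩ := h
  have hd' := near_le ha ha1 hT₀ hclean hy hw hwy hd
  have hpos : 0 < dist y w := dist_pos.2 hwy.symm
  obtain ⟨ε, hε0, hεs, hε1, hεd⟩ : ∃ ε : ℝ, 0 < ε ∧ ε ≤ s / 4 ∧ ε ≤ 1 / 100 ∧ ε ≤ dist y w / 4 :=
    ⟨min (s / 4) (min (1 / 100) (dist y w / 4)), lt_min (by linarith) (lt_min (by norm_num) (by linarith)), min_le_left _ _,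
      (min_le_right _ _).trans (min_le_left _ _), (min_le_right _ _).trans (min_le_right _ _)⟩
  obtain ⟨G, hG⟩ := recur4 hrec hy hw hy hw hε0
  refine ⟨G, fun q hq => ?_⟩
  obtain ⟨g, hg, hgq, ⟨y', hy', hyd⟩, ⟨w', hw', hwd⟩, -, -⟩ := hG q hq
  obtain ⟨hlo, hhi⟩ := dist_transport hyd hwd
  refine ⟨y', hy', w', hw', centre_transport hy0 hyd hgq (by linarith), ?_, by linarith, by linarith⟩
  intro heq
  rw [heq, dist_self] at hlo
  linarith

/-- Type SHORT recurs with bounded gaps. [this file] -/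
theorem shortAt_dense {s L : ℝ} {Y : Set (EuclideanSpace ℝ (Fin 3))} (hrec : UniformlyRecurrent Y) (hs : 0 < s) (h : ShortAt s L Y 0) :
    ∃ G : ℝ, ∀ q ∈ Y, ShortAt (s / 2) (L + G + 1) Y q := by
  obtain ⟨y, hy, w, hw, hy0, hwy, hshort⟩ := h
  have hpos : 0 < dist y w := dist_pos.2 hwy.symm
  obtain ⟨ε, hε0, hεs, hε1, hεd⟩ : ∃ ε : ℝ, 0 < ε ∧ ε ≤ s / 4 ∧ ε ≤ 1 / 100 ∧ ε ≤ dist y w / 4 :=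
    ⟨min (s / 4) (min (1 / 100) (dist y w / 4)), lt_min (by linarith) (lt_min (by norm_num) (by linarith)), min_le_left _ _,
      (min_le_right _ _).trans (min_le_left _ _), (min_le_right _ _).trans (min_le_right _ _)⟩
  obtain ⟨G, hG⟩ := recur4 hrec hy hw hy hw hε0
  refine ⟨G, fun q hq => ?_⟩
  obtain ⟨g, hg, hgq, ⟨y', hy', hyd⟩, ⟨w', hw', hwd⟩, -, -⟩ := hG q hq
  obtain ⟨hlo, hhi⟩ := dist_transport hyd hwd
  refine ⟨y', hy', w', hw', centre_transport hy0 hyd hgq (by linarith), ?_, by linarith⟩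
  intro heq
  rw [heq, dist_self] at hlo
  linarith

/-- Type LOWGAP recurs with bounded gaps. [this file] -/
theorem lowGapAt_dense {s L : ℝ} {Y : Set (EuclideanSpace ℝ (Fin 3))} (hrec : UniformlyRecurrent Y) (hs : 0 < s) (h : LowGapAt s L Y 0) :
    ∃ G : ℝ, ∀ q ∈ Y, LowGapAt (s / 2) (L + G + 1) Y q := by
  obtain ⟨y, hy, w, hw, hy0, hfar, hlow⟩ := h
  obtain ⟨ε, hε0, hεs, hε1, hεd⟩ : ∃ ε : ℝ, 0 < ε ∧ ε ≤ s / 4 ∧ ε ≤ 1 / 100 ∧ ε ≤ (dist y w - 11 / 10) / 4 :=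
    ⟨min (s / 4) (min (1 / 100) ((dist y w - 11 / 10) / 4)), lt_min (by linarith) (lt_min (by norm_num) (by linarith)),
      min_le_left _ _, (min_le_right _ _).trans (min_le_left _ _), (min_le_right _ _).trans (min_le_right _ _)⟩
  obtain ⟨G, hG⟩ := recur4 hrec hy hw hy hw hε0
  refine ⟨G, fun q hq => ?_⟩
  obtain ⟨g, hg, hgq, ⟨y', hy', hyd⟩, ⟨w', hw', hwd⟩, -, -⟩ := hG q hq
  obtain ⟨hlo, hhi⟩ := dist_transport hyd hwd
  exact ⟨y', hy', w', hw', centre_transport hy0 hyd hgq (by linarith), by linarith, by linarith⟩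

/-- Type CONTRAST recurs with bounded gaps. [this file] -/
theorem contrastAt_dense {a T₀ s L : ℝ} {Y : Set (EuclideanSpace ℝ (Fin 3))} (hrec : UniformlyRecurrent Y) (ha : 47 / 50 ≤ a)
    (ha1 : a ≤ 1) (hT₀ : T₀ ≤ 1 / 20) (hclean : ∀ y ∈ Y, RT a T₀ Y y) (hs : 0 < s) (h : ContrastAt s L Y 0) :
    ∃ G : ℝ, ∀ q ∈ Y, ContrastAt (s / 2) (L + G + 1) Y q := by
  obtain ⟨y, hy, w, hw, y₂, hy₂, w₂, hw₂, hy0, hy₂0, hwy, hwy₂, hd, hd₂, hcon⟩ := h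
  have hd' := near_le ha ha1 hT₀ hclean hy hw hwy hd
  have hd₂' := near_le ha ha1 hT₀ hclean hy₂ hw₂ hwy₂ hd₂
  have hpos : 0 < dist y w := dist_pos.2 hwy.symm
  have hpos₂ : 0 < dist y₂ w₂ := dist_pos.2 hwy₂.symm
  obtain ⟨ε, hε0, hεs, hε1, hεd, hεd₂⟩ : ∃ ε : ℝ, 0 < ε ∧ ε ≤ s / 4 ∧ ε ≤ 1 / 100 ∧ ε ≤ dist y w / 4 ∧ ε ≤ dist y₂ w₂ / 4 :=
    ⟨min (min (s / 4) (1 / 100)) (min (dist y w / 4) (dist y₂ w₂ / 4)),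
      lt_min (lt_min (by linarith) (by norm_num)) (lt_min (by linarith) (by linarith)),
      (min_le_left _ _).trans (min_le_left _ _), (min_le_left _ _).trans (min_le_right _ _),
      (min_le_right _ _).trans (min_le_left _ _), (min_le_right _ _).trans (min_le_right _ _)⟩
  obtain ⟨G, hG⟩ := recur4 hrec hy hw hy₂ hw₂ hε0
  refine ⟨G, fun q hq => ?_⟩
  obtain ⟨g, hg, hgq, ⟨y', hy', hyd⟩, ⟨w', hw', hwd⟩, ⟨y₂', hy₂', hy₂d⟩, ⟨w₂', hw₂', hw₂d⟩⟩ := hG q hq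
  obtain ⟨hlo, hhi⟩ := dist_transport hyd hwd
  obtain ⟨hlo₂, hhi₂⟩ := dist_transport hy₂d hw₂d
  refine ⟨y', hy', w', hw', y₂', hy₂', w₂', hw₂', centre_transport hy0 hyd hgq (by linarith),
    centre_transport hy₂0 hy₂d hgq (by linarith), ?_, ?_, by linarith, by linarith, by linarith⟩
  · intro heq
    rw [heq, dist_self] at hlo
    linarith
  · intro heq
    rw [heq, dist_self] at hlo₂
    linarith

/-- Type GAPCLASH recurs with bounded gaps. [this file] -/
theorem gapClashAt_dense {a T₀ s L : ℝ} {Y : Set (EuclideanSpace ℝ (Fin 3))} (hrec : UniformlyRecurrent Y) (ha : 47 / 50 ≤ a)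
    (ha1 : a ≤ 1) (hT₀ : T₀ ≤ 1 / 20) (hclean : ∀ y ∈ Y, RT a T₀ Y y) (hs : 0 < s) (h : GapClashAt s L Y 0) :
    ∃ G : ℝ, ∀ q ∈ Y, GapClashAt (s / 2) (L + G + 1) Y q := by
  obtain ⟨y, hy, w, hw, y₂, hy₂, w₂, hw₂, hy0, hy₂0, hwy, hd, hfar₂, hk⟩ := h
  have hd' := near_le ha ha1 hT₀ hclean hy hw hwy hd
  have hpos : 0 < dist y w := dist_pos.2 hwy.symm
  obtain ⟨ε, hε0, hεs, hε1, hεd, hεd₂⟩ :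
      ∃ ε : ℝ, 0 < ε ∧ ε ≤ s / 4 ∧ ε ≤ 1 / 100 ∧ ε ≤ dist y w / 4 ∧ ε ≤ (dist y₂ w₂ - 11 / 10) / 4 :=
    ⟨min (min (s / 4) (1 / 100)) (min (dist y w / 4) ((dist y₂ w₂ - 11 / 10) / 4)),
      lt_min (lt_min (by linarith) (by norm_num)) (lt_min (by linarith) (by linarith)),
      (min_le_left _ _).trans (min_le_left _ _), (min_le_left _ _).trans (min_le_right _ _),
      (min_le_right _ _).trans (min_le_left _ _), (min_le_right _ _).trans (min_le_right _ _)⟩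
  obtain ⟨G, hG⟩ := recur4 hrec hy hw hy₂ hw₂ hε0
  refine ⟨G, fun q hq => ?_⟩
  obtain ⟨g, hg, hgq, ⟨y', hy', hyd⟩, ⟨w', hw', hwd⟩, ⟨y₂', hy₂', hy₂d⟩, ⟨w₂', hw₂', hw₂d⟩⟩ := hG q hq
  obtain ⟨hlo, hhi⟩ := dist_transport hyd hwd
  obtain ⟨hlo₂, hhi₂⟩ := dist_transport hy₂d hw₂d
  refine ⟨y', hy', w', hw', y₂', hy₂', w₂', hw₂', centre_transport hy0 hyd hgq (by linarith),
    centre_transport hy₂0 hy₂d hgq (by linarith), ?_, by linarith, by linarith, by linarith⟩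
  intro heq
  rw [heq, dist_self] at hlo
  linarith

/-! ## §K  The typed split of the edge-relaxation law and its cones -/

/-- **The edge-relaxation law follows from the five typed laws** (`T₀ ≤ 1/20`): the violators of a strained texture give a type at the
root (§I, margin `t/2`), the type recurs with bounded gaps `G` (§J, margin `t/4`), and the typed law at `(t/4, L + G + 1)` gives the strained
cubes. [this file] -/
theorem edgeRelaxationLaw_of_typed {T₀ D : ℝ} (hT₀ : T₀ ≤ 1 / 20) (hLong : LongRelaxationLaw T₀ D) (hShort : ShortRelaxationLaw T₀ D)
    (hLow : LowGapRelaxationLaw T₀ D) (hCon : ContrastRelaxationLaw T₀ D) (hGap : GapClashRelaxationLaw T₀ D) :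
    EdgeRelaxationLaw T₀ D := by
  intro Y hY t ht L hV
  have hY' := hY
  obtain ⟨hUD, h0, hrec, hcov, ⟨b, hb1, hb2, hthin⟩, ⟨a, ha1, ha2, hclean⟩⟩ := hY
  have hviol : ∀ a' : ℝ, 47 / 50 ≤ a' → a' ≤ 1 → ∃ y ∈ Y, dist y 0 ≤ L ∧ ¬ RT a' (t / 2) Y y := by
    intro a' h1 h2
    obtain ⟨y, hy, hd, hn⟩ := hV a' h1 h2 0 h0
    exact ⟨y, hy, hd, hn (t / 2) (by linarith) (by linarith)⟩
  have ht2 : 0 < t / 2 := by linarith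
  have ht4 : 0 < t / 2 / 2 := by linarith
  rcases types_of_violators hUD ha1 ha2 hT₀ ht2.le hclean hviol with hL | hS | hG | hC | hK
  · obtain ⟨G, hG⟩ := longAt_dense hrec ha1 ha2 hT₀ hclean ht2 hL
    exact hLong Y hY' (t / 2 / 2) ht4 (L + G + 1) hG
  · obtain ⟨G, hG⟩ := shortAt_dense hrec ht2 hS
    exact hShort Y hY' (t / 2 / 2) ht4 (L + G + 1) hG
  · obtain ⟨G, hG⟩ := lowGapAt_dense hrec ht2 hG
    exact hLow Y hY' (t / 2 / 2) ht4 (L + G + 1) hG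
  · obtain ⟨G, hG⟩ := contrastAt_dense hrec ha1 ha2 hT₀ hclean ht2 hC
    exact hCon Y hY' (t / 2 / 2) ht4 (L + G + 1) hG
  · obtain ⟨G, hG⟩ := gapClashAt_dense hrec ha1 ha2 hT₀ hclean ht2 hK
    exact hGap Y hY' (t / 2 / 2) ht4 (L + G + 1) hG

/-- The typed laws give LIOUBᵘ (`0 ≤ T₀ ≤ 1/20`). [this file] -/
theorem liouBallsU_of_typed {T₀ D : ℝ} (hT₀ : 0 ≤ T₀) (hT₁ : T₀ ≤ 1 / 20) (hLong : LongRelaxationLaw T₀ D)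
    (hShort : ShortRelaxationLaw T₀ D) (hLow : LowGapRelaxationLaw T₀ D) (hCon : ContrastRelaxationLaw T₀ D)
    (hGap : GapClashRelaxationLaw T₀ D) : CleanLiouvilleBallsU T₀ D :=
  liouBallsU_of_edgeRelaxationLaw hT₀ (edgeRelaxationLaw_of_typed hT₁ hLong hShort hLow hCon hGap)

/-- **Cone with the typed laws**: `GrossCleanBallsU T₀ 10 →` the five typed relaxation laws at `(T₀, 10)` `→ CleanlessExcessT →
CoherentResidual 10 → RobustDefectLimitWindows` (`0 < T₀ ≤ 1/20`). [this file] -/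
theorem rdef_of_grossU_typed_coherent {T₀ : ℝ} (hT : 0 < T₀) (hT₁ : T₀ ≤ 1 / 20) (hG : GrossCleanBallsU T₀ 10)
    (hLong : LongRelaxationLaw T₀ 10) (hShort : ShortRelaxationLaw T₀ 10) (hLow : LowGapRelaxationLaw T₀ 10)
    (hCon : ContrastRelaxationLaw T₀ 10) (hGap : GapClashRelaxationLaw T₀ 10) (hCE : CleanlessExcessT) (hR : CoherentResidual 10) :
    RobustDefectLimitWindows :=
  rdef_of_grossU_edgeRelaxation_coherent hT hG (edgeRelaxationLaw_of_typed hT₁ hLong hShort hLow hCon hGap) hCE hR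

/-- The cone with the typed laws at the record numerals `T₀ = 1/250`. [this file] -/
theorem rdef_of_grossU_typed_record (hG : GrossCleanBallsU (1 / 250) 10)
    (hLong : LongRelaxationLaw (1 / 250) 10) (hShort : ShortRelaxationLaw (1 / 250) 10) (hLow : LowGapRelaxationLaw (1 / 250) 10)
    (hCon : ContrastRelaxationLaw (1 / 250) 10) (hGap : GapClashRelaxationLaw (1 / 250) 10) (hCE : CleanlessExcessT)
    (hR : CoherentResidual 10) : RobustDefectLimitWindows :=
  rdef_of_grossU_typed_coherent (T₀ := 1 / 250) (by norm_num) (by norm_num) hG hLong hShort hLow hCon hGap hCE hR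

end Summit.AtomisticToContinuum.Crystallization.Theorems.OverbindingBudgetEdgeRelaxationTyping

end
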